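import Mathlib.NumberTheory.NumberField.Cyclotomic.PID
import Mathlib.NumberTheory.NumberField.Cyclotomic.Ideal
import Mathlib.Analysis.Real.Pi.Bounds
import HarnessLib

/-!
# `ℚ(ζ₁₂) = ℚ(i, √3)` has class number one: `ℤ[ζ₁₂]` is a principal ideal domain

Topic `Literature/NumberTheory/NumberFields`, namespace `Literature.NumberTheory.NumberFields`.  Theorems only; no
definition, no named fact (net Literature debt 0).  The last cyclotomic field of degree `≤ 4` missing from the tree
(`ℚ(ζ₃)`, `ℚ(ζ₅)`: Mathlib `three_pid`, `five_pid`; `ℚ(ζ₄)`: `CyclotomicFieldFourClassNumber`; `ℚ(ζ₈)`: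
`CyclotomicFieldsEightSixteenClassNumber`): `ℚ(ζ₁₂)`, degree `φ(12) = 4`, discriminant `d = 2⁴ · 3² = 144` (Mathlib's general
`IsCyclotomicExtension.Rat.discr`), Minkowski constant `M_K = (4/π)² · (4!/4⁴) · 12 = 18/π² ≈ 1.82 < 2`: EVERY ideal class
contains an ideal of norm `1`, so `h = 1` with no prime to examine (Mathlib's Galois-case criterion over the empty range
`[2, 1]`).  An entry of Masley–Montgomery's list (Washington Thm. 11.1).

* `discr_of_isCyclotomicExtension_twelve` (`144`), `minkowskiBound_lt_two_of_isCyclotomicExtension_twelve`,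
  **`classNumber_eq_one_of_isCyclotomicExtension_twelve`**, `isPrincipalIdealRing_adjoin_of_isPrimitiveRoot_twelve` (`ℤ[ζ₁₂]` is a
  PID), `isPrincipalIdealRing_ringOfIntegers_cyclotomicField_twelve`, `classNumber_cyclotomicField_twelve`.

Consumers: the isomorphism classes of complex `2`-tori with an endomorphism of characteristic polynomial `Φ₁₂` (the lane's
`ComplexTorusCyclotomicAutomorphismOrderEightTwelve` has the isogeny statements).

## References

* [Washington1997] L. C. Washington, *Introduction to Cyclotomic Fields*, 2nd ed., GTM 83 (1997), Thm. 11.1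
  (Masley–Montgomery), Prop. 2.7 (discriminant).
* [Marcus2018] D. A. Marcus, *Number Fields*, 2nd ed. (2018), Ch. 5 Thm. 37 Cor. 2 (chunk p0107).
* [MasleyMontgomery1976] J. M. Masley, H. L. Montgomery, *Cyclotomic fields with unique factorization*, J. reine angew.
  Math. 286/287 (1976) 248–256.
-/

noncomputable section

namespace Literature.NumberTheory.NumberFields

open NumberField NumberField.InfinitePlace Polynomial Nat Real IsCyclotomicExtension.Rat Ideal
open scoped Real

section Twelve

variable (K : Type) [Field K] [NumberField K] [IsCyclotomicExtension {12} ℚ K]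

/-- **The discriminant of `ℚ(ζ₁₂)` is `2⁴ · 3² = 144`** (`(−1)^{φ(12)/2} 12⁴ / (2^{4/1} 3^{4/2})`). [cite: Washington1997, Prop. 2.7] -/
theorem discr_of_isCyclotomicExtension_twelve : NumberField.discr K = 144 := by
  have h := IsCyclotomicExtension.Rat.discr 12 K
  have hφ : Nat.totient 12 = 4 := by decide
  have hpf : (12 : ℕ).primeFactors = {2, 3} := by
    rw [show (12 : ℕ) = 2 ^ 2 * 3 from rfl, Nat.primeFactors_mul (by norm_num) (by norm_num),
      Nat.primeFactors_prime_pow (by norm_num) Nat.prime_two, Nat.Prime.primeFactors Nat.prime_three]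
    rfl
  rw [hφ, hpf, Finset.prod_pair (by norm_num)] at h
  rw [h]
  norm_num

/-- **The Minkowski constant of `ℚ(ζ₁₂)` is `< 2`**: `(4/π)² · (4!/4⁴) · √144 = 18/π² < (4/3)² · (3/32) · 12 = 2`, strictly
since `π > 3`. [cite: Marcus2018, Ch. 5 Thm. 37 Cor. 2 (p0107)] -/
theorem minkowskiBound_lt_two_of_isCyclotomicExtension_twelve :
    (4 / π) ^ nrComplexPlaces K * ((Module.finrank ℚ K)! / (Module.finrank ℚ K) ^ (Module.finrank ℚ K) *
      √|(NumberField.discr K : ℝ)|) < 2 := by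
  rw [discr_of_isCyclotomicExtension_twelve K, IsCyclotomicExtension.finrank (n := 12) K
    (cyclotomic.irreducible_rat (by norm_num)), nrComplexPlaces_eq_totient_div_two 12, show Nat.totient 12 = 4 by decide]
  have hπ : 4 / π < 4 / 3 := by
    apply div_lt_div_of_pos_left (by norm_num) (by norm_num) pi_gt_three
  have hπ0 : 0 ≤ 4 / π := by positivity
  have h2 : (4 / π) ^ (4 / 2) < (4 / 3 : ℝ) ^ (4 / 2) := by
    rw [show (4 / 2 : ℕ) = 2 by norm_num]
    gcongr
  have hsqrt : √|((144 : ℤ) : ℝ)| = 12 := by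
    rw [show |((144 : ℤ) : ℝ)| = 12 ^ 2 by norm_num, Real.sqrt_sq (by norm_num)]
  have hfac : ((4 : ℕ)! : ℝ) / (4 : ℕ) ^ (4 : ℕ) = 3 / 32 := by
    rw [show (4 : ℕ)! = 24 by rfl]
    norm_num
  rw [hfac, hsqrt]
  have hpos : (0 : ℝ) < 3 / 32 * 12 := by norm_num
  calc (4 / π) ^ (4 / 2) * (3 / 32 * (12 : ℝ))
      < (4 / 3 : ℝ) ^ (4 / 2) * (3 / 32 * 12) := mul_lt_mul_of_pos_right h2 hpos
    _ = 2 := by norm_num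

/-- `𝓞_K` is a principal ideal domain for a `12`-th cyclotomic extension `K/ℚ`: the Minkowski bound is `< 2`, so the
criterion has no prime to examine (public form: `classNumber_eq_one_of_isCyclotomicExtension_twelve`).
[cite: Marcus2018, Ch. 5 Thm. 37 Cor. 2 (p0107)] [cite: Washington1997, Thm. 11.1] -/
private theorem isPrincipalIdealRing_ringOfIntegers_twelve_aux : IsPrincipalIdealRing (𝓞 K) := by
  haveI : IsGalois ℚ K := IsCyclotomicExtension.isGalois {12} ℚ K
  have hM := minkowskiBound_lt_two_of_isCyclotomicExtension_twelve K
  have hfloor : ⌊(4 / π) ^ nrComplexPlaces K * ((Module.finrank ℚ K)! / (Module.finrank ℚ K) ^ (Module.finrank ℚ K) *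
      √|(NumberField.discr K : ℝ)|)⌋₊ ≤ 1 :=
    Nat.le_of_lt_succ ((Nat.floor_lt (by positivity)).2 hM)
  apply RingOfIntegers.isPrincipalIdealRing_of_isPrincipal_of_lt_or_isPrincipal_of_mem_primesOver_of_mem_Icc
  intro p hp hpp
  have hp1 : p ≤ 1 := (Finset.mem_Icc.1 hp).2.trans hfloor
  have hp2 : 2 ≤ p := hpp.two_le
  omega

end Twelve

/-! ### Class number one, for an arbitrary model `K`, and for Mathlib's `CyclotomicField 12 ℚ` -/

/-- **EVERY `12`-TH CYCLOTOMIC EXTENSION `K/ℚ` HAS CLASS NUMBER ONE** (`𝓞_K = ℤ[ζ₁₂]` is a principal ideal domain): the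
Minkowski constant `18/π² < 2`. [cite: Washington1997, Thm. 11.1] [cite: Marcus2018, Ch. 5 Thm. 37 Cor. 2 (p0107)]
[cite: MasleyMontgomery1976, Main Theorem] -/
theorem classNumber_eq_one_of_isCyclotomicExtension_twelve (K : Type) [Field K] [NumberField K]
    (hK : IsCyclotomicExtension {12} ℚ K) : classNumber K = 1 :=
  (classNumber_eq_one_iff (K := K)).2 (isPrincipalIdealRing_ringOfIntegers_twelve_aux K)

/-- **`ℤ[ζ₁₂]` IS A PRINCIPAL IDEAL DOMAIN**: for every primitive `12`-th root of unity `ζ` of a `12`-th cyclotomic extension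
`K/ℚ`, the order `ℤ[ζ]` (`= 𝓞_K`) is a principal ideal ring. [cite: Washington1997, Thm. 11.1] [cite: MasleyMontgomery1976, Main Theorem] -/
theorem isPrincipalIdealRing_adjoin_of_isPrimitiveRoot_twelve {K : Type} [Field K] [NumberField K]
    [IsCyclotomicExtension {12} ℚ K] {ζ : K} (hζ : IsPrimitiveRoot ζ 12) :
    IsPrincipalIdealRing (Algebra.adjoin ℤ ({ζ} : Set K)) :=
  haveI := isPrincipalIdealRing_ringOfIntegers_twelve_aux K
  IsPrincipalIdealRing.of_surjective hζ.adjoinEquivRingOfIntegers.symm hζ.adjoinEquivRingOfIntegers.symm.surjective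

/-- `CyclotomicField 12 ℚ` is a `12`-th cyclotomic extension of `ℚ` (Mathlib instance, recorded as a term). [folklore] -/
private theorem isCyclotomicExtension_cyclotomicField_twelve : IsCyclotomicExtension {12} ℚ (CyclotomicField 12 ℚ) :=
  CyclotomicField.isCyclotomicExtension 12 ℚ

/-- **The ring of integers of `CyclotomicField 12 ℚ` (`= ℤ[ζ₁₂]`) is a principal ideal domain.** [cite: Washington1997, Thm. 11.1]
[cite: MasleyMontgomery1976, Main Theorem] -/
theorem isPrincipalIdealRing_ringOfIntegers_cyclotomicField_twelve :
    IsPrincipalIdealRing (𝓞 (CyclotomicField 12 ℚ)) :=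
  haveI := isCyclotomicExtension_cyclotomicField_twelve
  isPrincipalIdealRing_ringOfIntegers_twelve_aux (CyclotomicField 12 ℚ)

/-- **`h(ℚ(ζ₁₂)) = 1`.** [cite: Washington1997, Thm. 11.1] [cite: MasleyMontgomery1976, Main Theorem] -/
theorem classNumber_cyclotomicField_twelve : classNumber (CyclotomicField 12 ℚ) = 1 :=
  (classNumber_eq_one_iff (K := CyclotomicField 12 ℚ)).2 isPrincipalIdealRing_ringOfIntegers_cyclotomicField_twelve

end Literature.NumberTheory.NumberFields

end
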